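import Mathlib

/-!
# Route `SymPencil` — inner rank of the `2 | 2` row split of `per_4`, PEELED case: padding a
# reduced family to exactly ten squares (`--supports` stmt-ValiantsHypothesis-5674
# `SdcSuperquadratic`; (8,8) column, memo `NOTE-p6g16-5674-R2-peeled-ten.md` §1)

`pad_to_ten`: a reduced family (`…InnerRankReducedFamily` data: non-zero weights, joint identity,
scalar outer blocks `v₀, v₀'`, peeled witness, row-`𝟙` coefficients `h`) on an index type `κ`
with `|κ| ≤ 10` yields one with the same shape on `κ ⊕ Fin (10 − |κ|)`, of cardinality exactly
`10` (weights `1` and zero maps on the new indices).  So the peeled-case theorems at `|κ| = 10`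
cover `|κ| ≤ 10`.  Honest framing: bookkeeping lemma; no cell closes; `27 ≤ sdc(per_4) ≤ 29`, the
crux and `VP ≠ VNP` untouched.  No definitions, no named facts. [folklore]
-/

noncomputable section

-- single-conjunct layout: Sub = Summit, duplicated namespace component intended
set_option linter.dupNamespace false

namespace Summit.ValiantsHypothesis.ValiantsHypothesis.Theorems.SymPencilPerFourPeeledPad

open Matrix Finset

universe u v

variable {K : Type u} [Field K]

/-- **Padding a reduced family to ten squares.**  See the module docstring. [folklore] -/
theorem pad_to_ten {κ : Type v} [Fintype κ] [DecidableEq κ] (hκ : Fintype.card κ ≤ 10)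
    (c : κ → K) (hc : ∀ r, c r ≠ 0)
    (t : κ → (((Fin 4 → K) × (Fin 4 → K)) →ₗ[K] ((Fin 4 → K) × (Fin 4 → K)) →ₗ[K] K))
    (hJ : ∀ a b y₂ y₃ : Fin 4 → K,
      ∑ r, c r * (t r (a, b) (y₂, y₃)) ^ 2 = (Matrix.of ![a, b, y₂, y₃]).permanent)
    (v₀ v₀' : κ → K) (hv₀ : ∀ (a x : Fin 4 → K), ∃ s : K, (fun r => t r (a, 0) (x, 0)) = s • v₀)
    (hv₀' : ∀ (b x : Fin 4 → K), ∃ s : K, (fun r => t r (0, b) (0, x)) = s • v₀')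
    (hpeel : ∃ a b y z : Fin 4 → K, ∑ r, c r * t r (a, 0) (y, 0) * t r (0, b) (0, z) ≠ 0)
    (h : Fin 4 → K) (hh : ∀ k r, t r ((fun _ => 1), 0) (Pi.single k 1, 0) = h k * v₀ r) :
    ∃ (κ' : Type v) (_ : Fintype κ') (_ : DecidableEq κ') (c' : κ' → K)
      (t' : κ' → (((Fin 4 → K) × (Fin 4 → K)) →ₗ[K] ((Fin 4 → K) × (Fin 4 → K)) →ₗ[K] K))
      (w₀ w₀' : κ' → K),
      Fintype.card κ' = 10 ∧ (∀ r, c' r ≠ 0) ∧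
      (∀ a b y₂ y₃ : Fin 4 → K,
        ∑ r, c' r * (t' r (a, b) (y₂, y₃)) ^ 2 = (Matrix.of ![a, b, y₂, y₃]).permanent) ∧
      (∀ (a x : Fin 4 → K), ∃ s : K, (fun r => t' r (a, 0) (x, 0)) = s • w₀) ∧
      (∀ (b x : Fin 4 → K), ∃ s : K, (fun r => t' r (0, b) (0, x)) = s • w₀') ∧
      (∃ a b y z : Fin 4 → K, ∑ r, c' r * t' r (a, 0) (y, 0) * t' r (0, b) (0, z) ≠ 0) ∧
      (∀ k r, t' r ((fun _ => 1), 0) (Pi.single k 1, 0) = h k * w₀ r) := by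
  classical
  set m : ℕ := 10 - Fintype.card κ with hm
  refine ⟨κ ⊕ Fin m, inferInstance, inferInstance, Sum.elim c (fun _ => 1),
    Sum.elim t (fun _ => 0), Sum.elim v₀ 0, Sum.elim v₀' 0, ?_, ?_, ?_, ?_, ?_, ?_, ?_⟩
  · rw [Fintype.card_sum, Fintype.card_fin, hm]; omega
  · rintro (r | r)
    · exact hc r
    · exact one_ne_zero
  · intro a b y₂ y₃
    rw [Fintype.sum_sum_type, ← hJ a b y₂ y₃]
    simp
  · intro a x
    obtain ⟨s, hs⟩ := hv₀ a x
    refine ⟨s, funext fun r => ?_⟩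
    rcases r with r | r
    · have := congr_fun hs r; simpa using this
    · simp
  · intro b x
    obtain ⟨s, hs⟩ := hv₀' b x
    refine ⟨s, funext fun r => ?_⟩
    rcases r with r | r
    · have := congr_fun hs r; simpa using this
    · simp
  · obtain ⟨a, b, y, z, hne⟩ := hpeel
    refine ⟨a, b, y, z, ?_⟩
    rw [Fintype.sum_sum_type]
    simpa using hne
  · rintro k (r | r)
    · simpa using hh k r
    · simp

end Summit.ValiantsHypothesis.ValiantsHypothesis.Theorems.SymPencilPerFourPeeledPad

end
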